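import Literature.MathematicalPhysics.QuantumLattice.AngularCutoffLineBounds
import Literature.MathematicalPhysics.QuantumLattice.SectorPartitionOfUnityCircle
import HarnessLib

/-!
# Named constants for the angular sector cutoffs: the derivative bounds of `ζ̃_{n,ω}` and of `ζ̃_{n,ω}(θ(q⃗ + t w⃗))` up to order two

Topic `MathematicalPhysics/QuantumLattice`.  The angular partition of unity `sectorWeightCirc n ω` (BGM 2006 (2.45)) is built on Mathlib's
`ContDiffBump`, whose profile is a CHOICE (`someContDiffBumpBase ℝ = Nonempty.some _`): its derivative bounds exist
(`abs_iteratedDeriv_sectorWeightCirc_le`, `exists_norm_iteratedDeriv_sectorWeightCirc_polarAngle_line_le'`) but are not numerals.  For the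
explicit-constant bookkeeping of the K3 engine's scale-`0` step (the sector-function size `b₀`, cell gate-hubbard-kl) this file NAMES them once,
by `Classical.choose`, so that downstream closed-form constants can be written:

* `sectorCircDerivConst m` with `sectorCircDerivConst_nonneg`, **`abs_iteratedDeriv_sectorWeightCirc_le_const`**
  (`|ζ̃_{n,ω}^{(m)}(θ)| ≤ sectorCircDerivConst m · w_n^{-m}`), and the order-`0,1,2` forms at scale `0` (`w_0 = π`):
  `abs_deriv_sectorWeightCirc_zero_le`, `abs_deriv_deriv_sectorWeightCirc_zero_le`;
* `sectorCircLineConst` (the constant `B` of the line lemma for `N = 2`) with `sectorCircLineConst_nonneg` and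
  **`norm_iteratedDeriv_sectorWeightCirc_polarAngle_line_le_const`** (`i ≤ 2`, every `n`), and the scale-`0` unit-direction form
  `norm_iteratedDeriv_sectorWeightCirc_zero_line_le` (`‖∂ₜⁱ ζ̃_{0,ω}(θ(q⃗ + t w⃗))‖ ≤ sectorCircLineConst · (3‖w⃗‖/r₀)ⁱ`).

Everything is proved; the two definitions are `Classical.choose` of landed existence theorems; no named facts.

## Sources

G. Benfatto, A. Giuliani, V. Mastropietro, Ann. Henri Poincaré 7 (2006) 809–898, §2.5 (2.45)–(2.46), Lemma 2.2
[`BenfattoGiulianiMastropietro2006`].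
-/

noncomputable section

namespace Literature.MathematicalPhysics.QuantumLattice

open Real

/-! ### The derivative constants of `ζ̃_{n,ω}` -/

/-- **The named `m`-th derivative constant of the angular partition**: `|ζ̃_{n,ω}^{(m)}| ≤ C_m w_n^{-m}` with `C_m = sectorCircDerivConst m`
(a choice from `abs_iteratedDeriv_sectorWeightCirc_le`). [cite: BenfattoGiulianiMastropietro2006, §2.5 Lemma 2.2] -/
def sectorCircDerivConst (m : ℕ) : ℝ := Classical.choose (abs_iteratedDeriv_sectorWeightCirc_le m)

/-- `0 ≤ C_m`. [cite: BenfattoGiulianiMastropietro2006, §2.5 Lemma 2.2] -/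
theorem sectorCircDerivConst_nonneg (m : ℕ) : 0 ≤ sectorCircDerivConst m :=
  (Classical.choose_spec (abs_iteratedDeriv_sectorWeightCirc_le m)).1

/-- **`|ζ̃_{n,ω}^{(m)}(θ)| ≤ C_m · w_n^{-m}`** for every scale, sector and angle. [cite: BenfattoGiulianiMastropietro2006, §2.5 Lemma 2.2] -/
theorem abs_iteratedDeriv_sectorWeightCirc_le_const (m n : ℕ) (ω : ℤ) (θ : ℝ) :
    |iteratedDeriv m (sectorWeightCirc n ω) θ| ≤ sectorCircDerivConst m * (sectorWidth n)⁻¹ ^ m :=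
  (Classical.choose_spec (abs_iteratedDeriv_sectorWeightCirc_le m)).2 n ω θ

/-- At scale `0` (`w_0 = π`): `|ζ̃_{0,ω}′(θ)| ≤ C₁/π`. [cite: BenfattoGiulianiMastropietro2006, §2.5 Lemma 2.2] -/
theorem abs_deriv_sectorWeightCirc_zero_le (ω : ℤ) (θ : ℝ) :
    |deriv (sectorWeightCirc 0 ω) θ| ≤ sectorCircDerivConst 1 / π := by
  have h := abs_iteratedDeriv_sectorWeightCirc_le_const 1 0 ω θ
  rw [iteratedDeriv_one, pow_one, sectorWidth, pow_zero, div_one] at h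
  rwa [div_eq_mul_inv]

/-- At scale `0`: `|ζ̃_{0,ω}″(θ)| ≤ C₂/π²`. [cite: BenfattoGiulianiMastropietro2006, §2.5 Lemma 2.2] -/
theorem abs_deriv_deriv_sectorWeightCirc_zero_le (ω : ℤ) (θ : ℝ) :
    |deriv (deriv (sectorWeightCirc 0 ω)) θ| ≤ sectorCircDerivConst 2 / π ^ 2 := by
  have h := abs_iteratedDeriv_sectorWeightCirc_le_const 2 0 ω θ
  rw [iteratedDeriv_succ, iteratedDeriv_one, sectorWidth, pow_zero, div_one, inv_pow] at h
  rwa [div_eq_mul_inv]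

/-! ### The line constant (orders `≤ 2`) -/

/-- **The named constant of the angular line lemma for orders `≤ 2`** (a choice from
`exists_norm_iteratedDeriv_sectorWeightCirc_polarAngle_line_le' 2`). [cite: BenfattoGiulianiMastropietro2006, §2.5 Lemma 2.2] -/
def sectorCircLineConst : ℝ := Classical.choose (exists_norm_iteratedDeriv_sectorWeightCirc_polarAngle_line_le' 2)

/-- `0 ≤ B`. [cite: BenfattoGiulianiMastropietro2006, §2.5 Lemma 2.2] -/
theorem sectorCircLineConst_nonneg : 0 ≤ sectorCircLineConst :=
  (Classical.choose_spec (exists_norm_iteratedDeriv_sectorWeightCirc_polarAngle_line_le' 2)).1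

/-- **The angular cutoff along a line, orders `i ≤ 2`, every scale**: on `‖q⃗ + t w⃗‖ ≥ r₀ > 0` and off the cut of the relative angle,
`‖∂ₜⁱ ζ̃_{n,ω}(θ(q⃗ + t w⃗))‖ ≤ B · (3·2ⁿ‖w⃗‖/r₀)ⁱ` with `B = sectorCircLineConst`. [cite: BenfattoGiulianiMastropietro2006, §2.5 Lemma 2.2] -/
theorem norm_iteratedDeriv_sectorWeightCirc_polarAngle_line_le_const {i : ℕ} (hi : i ≤ 2) (n : ℕ) (ω : ℤ) (θ₀ : ℝ)
    (q w : Fin 2 → ℝ) (t : ℝ) {r₀ : ℝ} (hr₀ : 0 < r₀) (hr : r₀ ≤ ‖momToComplex (q + t • w)‖) (hΘ : |sectorRelAngle θ₀ (q + t • w)| < π) :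
    ‖iteratedDeriv i (fun t : ℝ => sectorWeightCirc n ω (polarAngle (q + t • w))) t‖ ≤
      sectorCircLineConst * ((3 : ℝ) * (2 : ℝ) ^ n * ‖momToComplex w‖ / r₀) ^ i := by
  have h := (Classical.choose_spec (exists_norm_iteratedDeriv_sectorWeightCirc_polarAngle_line_le' 2)).2 i hi n ω θ₀ q w t hr₀ hr hΘ
  have h3 : ((1 + (Nat.factorial 2 : ℝ)) * (2 : ℝ) ^ n * ‖momToComplex w‖ / r₀) = (3 : ℝ) * (2 : ℝ) ^ n * ‖momToComplex w‖ / r₀ := by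
    norm_num [Nat.factorial]
  rw [h3] at h
  exact h

/-- **At scale `0`** (two sectors, `2⁰ = 1`): `‖∂ₜⁱ ζ̃_{0,ω}(θ(q⃗ + t w⃗))‖ ≤ B · (3‖w⃗‖/r₀)ⁱ` for `i ≤ 2`. [cite: BenfattoGiulianiMastropietro2006, §2.5 Lemma 2.2] -/
theorem norm_iteratedDeriv_sectorWeightCirc_zero_line_le {i : ℕ} (hi : i ≤ 2) (ω : ℤ) (θ₀ : ℝ) (q w : Fin 2 → ℝ) (t : ℝ)
    {r₀ : ℝ} (hr₀ : 0 < r₀) (hr : r₀ ≤ ‖momToComplex (q + t • w)‖) (hΘ : |sectorRelAngle θ₀ (q + t • w)| < π) :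
    ‖iteratedDeriv i (fun t : ℝ => sectorWeightCirc 0 ω (polarAngle (q + t • w))) t‖ ≤
      sectorCircLineConst * ((3 : ℝ) * ‖momToComplex w‖ / r₀) ^ i := by
  have h := norm_iteratedDeriv_sectorWeightCirc_polarAngle_line_le_const hi 0 ω θ₀ q w t hr₀ hr hΘ
  simpa using h

end Literature.MathematicalPhysics.QuantumLattice

end
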